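import Summits.Ventures.HodgeRepro2.T5SU11LegendreSeriesRate

/-!
# The rate of convergence of the Legendre series of a `C⁶` function: `sup_{[−1,1]} |f − S_d f| ≤ ‖L³f‖₂ / d⁵`

The third step of the pattern `C^{2m} ⟹ O(d^{1−2m})` (rows 432, 425: `m = 1, 2`). For `f` six times differentiable
on `[−1, 1]` with continuous sixth derivative (`h₁`–`h₆`, `h₆c`: `f_j = f^{(j)}`) the function `g = Lf` is `C⁴` with
`g′ = (1 − x²) f‴ − 4x f″ − 2 f′`, `g″ = (1 − x²) f⁗ − 6x f‴ − 6 f″` (row 425), `g‴ = (1 − x²) f⁽⁵⁾ − 8x f⁗ − 12 f‴`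
(`sturmDeriv3`) and `g⁗ = (1 − x²) f⁽⁶⁾ − 10x f⁽⁵⁾ − 20 f⁗` (`sturmDeriv4`), so row 425 applies to `g` and row 422 to
`f`: **`c_k(f) = −c_k(L³f)/(k(k + 1))³`** (`fourierLegendre_eq_sturm3`, `L³f = L²(Lf)` as `sturm3`). The weights
`w_j = √((2j + 1)/2)/(j(j + 1))³` satisfy `w_j² ≤ 1/j¹¹` (`weight_sq_le3`) and `Σ_{k<n} w_{k+d+1}² ≤ d⁻¹⁰`
(`sum_weight_sq_le3`), hence

  **`|f(x) − S_d f(x)| ≤ √(∫_{−1}^{1} (L³f)²) / d⁵` for every `x ∈ [−1, 1]` and `d ≥ 1`**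
  (`abs_sub_partialSum_le_div_pow_five`, and `abs_sub_partialSum_le_div_pow_five_of_contDiff` for `f ∈ C⁶(ℝ)`).

Nothing is claimed about (N).

Blind lane: Mathlib + the HodgeRepro2 prefix only; no sorry; axioms ⊆ {propext, Classical.choice,
Quot.sound}.
-/

namespace Summit.Ventures.HodgeRepro2.T5SU11LegendreSeriesRateC6

open Polynomial intervalIntegral Finset Filter Topology MeasureTheory
open Set (Icc Ioc Ioo uIcc uIoc EqOn)
open T5SU11SphericalLegendreAll T5SU11LegendreIdentities T5SU11LegendreOrthogonal
  T5SU11LegendreSeries T5SU11LegendreCoefficientDecay T5SU11LegendreSeriesUniform T5SU11LegendreSeriesRate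

/-! ### The third and fourth derivatives of `Lf`, and `L³f` -/

/-- **`(L f)‴ = (1 − x²) f⁽⁵⁾ − 8x f⁗ − 12 f‴`.** -/
noncomputable def sturmDeriv3 (f₃ f₄ f₅ : ℝ → ℝ) (x : ℝ) : ℝ := (1 - x ^ 2) * f₅ x - 8 * x * f₄ x - 12 * f₃ x

/-- **`(L f)⁗ = (1 − x²) f⁽⁶⁾ − 10x f⁽⁵⁾ − 20 f⁗`.** -/
noncomputable def sturmDeriv4 (f₄ f₅ f₆ : ℝ → ℝ) (x : ℝ) : ℝ := (1 - x ^ 2) * f₆ x - 10 * x * f₅ x - 20 * f₄ x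

/-- **`L³f = L²(Lf)`**, the Sturm–Liouville operator applied three times. -/
noncomputable def sturm3 (f₁ f₂ f₃ f₄ f₅ f₆ : ℝ → ℝ) : ℝ → ℝ :=
  sturm2 (sturmDeriv f₁ f₂ f₃) (sturmDeriv2 f₂ f₃ f₄) (sturmDeriv3 f₃ f₄ f₅) (sturmDeriv4 f₄ f₅ f₆)

section C6

variable {f f₁ f₂ f₃ f₄ f₅ f₆ : ℝ → ℝ}
  (h₁ : ∀ x ∈ Icc (-1 : ℝ) 1, HasDerivAt f (f₁ x) x)
  (h₂ : ∀ x ∈ Icc (-1 : ℝ) 1, HasDerivAt f₁ (f₂ x) x)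
  (h₃ : ∀ x ∈ Icc (-1 : ℝ) 1, HasDerivAt f₂ (f₃ x) x)
  (h₄ : ∀ x ∈ Icc (-1 : ℝ) 1, HasDerivAt f₃ (f₄ x) x)
  (h₅ : ∀ x ∈ Icc (-1 : ℝ) 1, HasDerivAt f₄ (f₅ x) x)
  (h₆ : ∀ x ∈ Icc (-1 : ℝ) 1, HasDerivAt f₅ (f₆ x) x)
  (h₆c : ContinuousOn f₆ (Icc (-1 : ℝ) 1))

omit h₁ h₂ h₆ h₆c in
include h₃ h₄ h₅ in
/-- `(L f)″` has derivative `(L f)‴` on `[−1, 1]`. -/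
theorem hasDerivAt_sturmDeriv2 {x : ℝ} (hx : x ∈ Icc (-1 : ℝ) 1) :
    HasDerivAt (sturmDeriv2 f₂ f₃ f₄) (sturmDeriv3 f₃ f₄ f₅ x) x := by
  have hA := ((hasDerivAt_const x (1 : ℝ)).sub (hasDerivAt_pow 2 x)).mul (h₅ x hx)
  have hB := ((hasDerivAt_const x (6 : ℝ)).mul (hasDerivAt_id x)).mul (h₄ x hx)
  have hC := (h₃ x hx).const_mul (6 : ℝ)
  have h := (hA.sub hB).sub hC
  refine (h.congr_deriv ?_).congr_of_eventuallyEq (Filter.Eventually.of_forall fun y => ?_)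
  · simp only [sturmDeriv3, Pi.sub_apply, Pi.mul_apply, id]
    push_cast
    ring
  · simp only [sturmDeriv2, Pi.sub_apply, Pi.mul_apply, id]

omit h₁ h₂ h₃ h₆c in
include h₄ h₅ h₆ in
/-- `(L f)‴` has derivative `(L f)⁗` on `[−1, 1]`. -/
theorem hasDerivAt_sturmDeriv3 {x : ℝ} (hx : x ∈ Icc (-1 : ℝ) 1) :
    HasDerivAt (sturmDeriv3 f₃ f₄ f₅) (sturmDeriv4 f₄ f₅ f₆ x) x := by
  have hA := ((hasDerivAt_const x (1 : ℝ)).sub (hasDerivAt_pow 2 x)).mul (h₆ x hx)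
  have hB := ((hasDerivAt_const x (8 : ℝ)).mul (hasDerivAt_id x)).mul (h₅ x hx)
  have hC := (h₄ x hx).const_mul (12 : ℝ)
  have h := (hA.sub hB).sub hC
  refine (h.congr_deriv ?_).congr_of_eventuallyEq (Filter.Eventually.of_forall fun y => ?_)
  · simp only [sturmDeriv4, Pi.sub_apply, Pi.mul_apply, id]
    push_cast
    ring
  · simp only [sturmDeriv3, Pi.sub_apply, Pi.mul_apply, id]

omit h₁ h₂ h₃ h₄ in
include h₅ h₆ h₆c in
/-- `(L f)⁗` is continuous on `[−1, 1]`. -/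
theorem continuousOn_sturmDeriv4 : ContinuousOn (sturmDeriv4 f₄ f₅ f₆) (Icc (-1 : ℝ) 1) := by
  have c₄ : ContinuousOn f₄ (Icc (-1 : ℝ) 1) := fun x hx => (h₅ x hx).continuousAt.continuousWithinAt
  have c₅ : ContinuousOn f₅ (Icc (-1 : ℝ) 1) := fun x hx => (h₆ x hx).continuousAt.continuousWithinAt
  have hA : ContinuousOn (fun x : ℝ => (1 - x ^ 2) * f₆ x) (Icc (-1 : ℝ) 1) :=
    (continuous_const.sub (continuous_pow 2)).continuousOn.mul h₆c
  have hB : ContinuousOn (fun x : ℝ => 10 * x * f₅ x) (Icc (-1 : ℝ) 1) :=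
    (continuous_const.mul continuous_id).continuousOn.mul c₅
  have hC : ContinuousOn (fun x : ℝ => 20 * f₄ x) (Icc (-1 : ℝ) 1) := c₄.const_smul (20 : ℝ)
  exact (hA.sub hB).sub hC

include h₁ h₂ h₃ h₄ h₅ h₆ h₆c in
/-- **`c_k(f) = −c_k(L³f)/(k(k + 1))³`** for `k ≥ 1` (row 422 for `f`, row 425 for `Lf`). -/
theorem fourierLegendre_eq_sturm3 {k : ℕ} (hk : 1 ≤ k) :
    fourierLegendre f k = -fourierLegendre (sturm3 f₁ f₂ f₃ f₄ f₅ f₆) k / ((k : ℝ) * ((k : ℝ) + 1)) ^ 3 := by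
  have c₂ : ContinuousOn f₂ (Icc (-1 : ℝ) 1) := fun x hx => (h₃ x hx).continuousAt.continuousWithinAt
  have e1 := fourierLegendre_eq_sturm h₁ h₂ c₂ hk
  have e2 := fourierLegendre_eq_sturm2 (fun _ hx => hasDerivAt_sturm h₂ h₃ hx)
    (fun _ hx => hasDerivAt_sturmDeriv h₂ h₃ h₄ hx) (fun _ hx => hasDerivAt_sturmDeriv2 h₃ h₄ h₅ hx)
    (fun _ hx => hasDerivAt_sturmDeriv3 h₄ h₅ h₆ hx) (continuousOn_sturmDeriv4 h₅ h₆ h₆c) hk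
  rw [e1, e2, sturm3]
  have hne : (k : ℝ) * ((k : ℝ) + 1) ≠ 0 := by
    have : (1 : ℝ) ≤ (k : ℝ) := by exact_mod_cast hk
    positivity
  field_simp

omit h₁ in
include h₂ h₃ h₄ h₅ h₆ h₆c in
/-- `L³f` is continuous on `[−1, 1]`. -/
theorem continuousOn_sturm3 : ContinuousOn (sturm3 f₁ f₂ f₃ f₄ f₅ f₆) (Icc (-1 : ℝ) 1) :=
  continuousOn_sturm2 (fun _ hx => hasDerivAt_sturmDeriv h₂ h₃ h₄ hx) (fun _ hx => hasDerivAt_sturmDeriv2 h₃ h₄ h₅ hx)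
    (fun _ hx => hasDerivAt_sturmDeriv3 h₄ h₅ h₆ hx) (continuousOn_sturmDeriv4 h₅ h₆ h₆c)

end C6

/-! ### The weight sums -/

/-- The weight `w_j = √((2j + 1)/2)/(j(j + 1))³` satisfies `w_j² ≤ 1/j¹¹` (`j ≥ 1`). -/
theorem weight_sq_le3 {j : ℕ} (hj : 1 ≤ j) :
    (Real.sqrt ((2 * (j : ℝ) + 1) / 2) / ((j : ℝ) * ((j : ℝ) + 1)) ^ 3) ^ 2 ≤ 1 / (j : ℝ) ^ 11 := by
  have hj' : (1 : ℝ) ≤ (j : ℝ) := by exact_mod_cast hj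
  rw [div_pow, Real.sq_sqrt (by positivity), div_le_div_iff₀ (by positivity) (by positivity), one_mul]
  have h2 : (((j : ℝ) * ((j : ℝ) + 1)) ^ 3) ^ 2 = (j : ℝ) ^ 6 * ((j : ℝ) + 1) ^ 6 := by ring
  rw [h2]
  have h3 : (0 : ℝ) ≤ (j : ℝ) ^ 6 := by positivity
  have h1 : (2 * (j : ℝ) + 1) * (j : ℝ) ^ 5 ≤ 2 * ((j : ℝ) + 1) ^ 6 := by
    have h5 : (j : ℝ) ^ 5 ≤ ((j : ℝ) + 1) ^ 5 := pow_le_pow_left₀ (by positivity) (by linarith) 5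
    nlinarith [h5, pow_pos (by linarith : (0 : ℝ) < (j : ℝ) + 1) 5]
  have h4 : (2 * (j : ℝ) + 1) * (j : ℝ) ^ 11 ≤ 2 * ((j : ℝ) ^ 6 * ((j : ℝ) + 1) ^ 6) := by
    have := mul_le_mul_of_nonneg_left h1 h3
    nlinarith [this]
  linarith

/-- **`Σ_{k<n} w_{k+d+1}² ≤ 1/d¹⁰`** for `d ≥ 1`. -/
theorem sum_weight_sq_le3 {d : ℕ} (hd : 1 ≤ d) (n : ℕ) :
    ∑ k ∈ range n, (Real.sqrt ((2 * ((k + (d + 1) : ℕ) : ℝ) + 1) / 2)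
        / (((k + (d + 1) : ℕ) : ℝ) * (((k + (d + 1) : ℕ) : ℝ) + 1)) ^ 3) ^ 2 ≤ 1 / (d : ℝ) ^ 10 := by
  have hd' : (1 : ℝ) ≤ (d : ℝ) := by exact_mod_cast hd
  calc ∑ k ∈ range n, (Real.sqrt ((2 * ((k + (d + 1) : ℕ) : ℝ) + 1) / 2)
          / (((k + (d + 1) : ℕ) : ℝ) * (((k + (d + 1) : ℕ) : ℝ) + 1)) ^ 3) ^ 2
      ≤ ∑ k ∈ range n, 1 / (d : ℝ) ^ 9 * (1 / ((k : ℝ) + d + 1) ^ 2) := by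
        refine Finset.sum_le_sum fun k _ => ?_
        refine (weight_sq_le3 (by omega)).trans ?_
        push_cast
        rw [show (k : ℝ) + ((d : ℝ) + 1) = (k : ℝ) + d + 1 by ring]
        have hk : (d : ℝ) ≤ (k : ℝ) + d + 1 := by linarith [(Nat.cast_nonneg k : (0 : ℝ) ≤ k)]
        have hpos : (0 : ℝ) < (k : ℝ) + d + 1 := by positivity
        rw [div_mul_div_comm, one_mul, div_le_div_iff₀ (by positivity) (by positivity), one_mul, one_mul]
        calc (d : ℝ) ^ 9 * ((k : ℝ) + d + 1) ^ 2 ≤ ((k : ℝ) + d + 1) ^ 9 * ((k : ℝ) + d + 1) ^ 2 :=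
              mul_le_mul_of_nonneg_right (pow_le_pow_left₀ (by positivity) hk 9) (by positivity)
          _ = ((k : ℝ) + d + 1) ^ 11 := by ring
    _ = 1 / (d : ℝ) ^ 9 * ∑ k ∈ range n, 1 / ((k : ℝ) + d + 1) ^ 2 := by rw [Finset.mul_sum]
    _ ≤ 1 / (d : ℝ) ^ 9 * (1 / d) := by
        refine mul_le_mul_of_nonneg_left ((sum_inv_sq_shift_le hd n).trans ?_) (by positivity)
        have : (0 : ℝ) ≤ 1 / ((n : ℝ) + d) := by positivity
        linarith
    _ = 1 / (d : ℝ) ^ 10 := by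
        field_simp

/-! ### The rate -/

section C6

variable {f f₁ f₂ f₃ f₄ f₅ f₆ : ℝ → ℝ}
  (h₁ : ∀ x ∈ Icc (-1 : ℝ) 1, HasDerivAt f (f₁ x) x)
  (h₂ : ∀ x ∈ Icc (-1 : ℝ) 1, HasDerivAt f₁ (f₂ x) x)
  (h₃ : ∀ x ∈ Icc (-1 : ℝ) 1, HasDerivAt f₂ (f₃ x) x)
  (h₄ : ∀ x ∈ Icc (-1 : ℝ) 1, HasDerivAt f₃ (f₄ x) x)
  (h₅ : ∀ x ∈ Icc (-1 : ℝ) 1, HasDerivAt f₄ (f₅ x) x)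
  (h₆ : ∀ x ∈ Icc (-1 : ℝ) 1, HasDerivAt f₅ (f₆ x) x)
  (h₆c : ContinuousOn f₆ (Icc (-1 : ℝ) 1))
include h₁ h₂ h₃ h₄ h₅ h₆ h₆c

/-- **The tail of the coefficient series of a `C⁶` function**: `Σ_{k<n} |c_{k+d+1}(f)| ≤ √(∫ (L³f)²) / d⁵`. -/
theorem sum_abs_fourierLegendre_shift_le3 {d : ℕ} (hd : 1 ≤ d) (n : ℕ) :
    ∑ k ∈ range n, |fourierLegendre f (k + (d + 1))|
      ≤ Real.sqrt (∫ x in (-1 : ℝ)..1, sturm3 f₁ f₂ f₃ f₄ f₅ f₆ x ^ 2) / (d : ℝ) ^ 5 := by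
  set g := sturm3 f₁ f₂ f₃ f₄ f₅ f₆ with hg
  have hgc : ContinuousOn g (Icc (-1 : ℝ) 1) := continuousOn_sturm3 h₂ h₃ h₄ h₅ h₆ h₆c
  have hd' : (1 : ℝ) ≤ (d : ℝ) := by exact_mod_cast hd
  have hfac : ∀ k ∈ range n, |fourierLegendre f (k + (d + 1))|
      = (|fourierLegendre g (k + (d + 1))| * Real.sqrt (2 / (2 * ((k + (d + 1) : ℕ) : ℝ) + 1)))
        * (Real.sqrt ((2 * ((k + (d + 1) : ℕ) : ℝ) + 1) / 2)
          / (((k + (d + 1) : ℕ) : ℝ) * (((k + (d + 1) : ℕ) : ℝ) + 1)) ^ 3) := by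
    intro k _
    have hk1 : 1 ≤ k + (d + 1) := by omega
    have hkpos : (0 : ℝ) < (((k + (d + 1) : ℕ) : ℝ) * (((k + (d + 1) : ℕ) : ℝ) + 1)) ^ 3 := by positivity
    rw [fourierLegendre_eq_sturm3 h₁ h₂ h₃ h₄ h₅ h₆ h₆c hk1, abs_div, abs_neg, abs_of_pos hkpos]
    have hs : Real.sqrt (2 / (2 * ((k + (d + 1) : ℕ) : ℝ) + 1))
        * Real.sqrt ((2 * ((k + (d + 1) : ℕ) : ℝ) + 1) / 2) = 1 := by
      rw [← Real.sqrt_mul (by positivity)]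
      have : (2 / (2 * ((k + (d + 1) : ℕ) : ℝ) + 1)) * ((2 * ((k + (d + 1) : ℕ) : ℝ) + 1) / 2) = 1 := by
        field_simp
      rw [this, Real.sqrt_one]
    calc |fourierLegendre g (k + (d + 1))| / (((k + (d + 1) : ℕ) : ℝ) * (((k + (d + 1) : ℕ) : ℝ) + 1)) ^ 3
        = |fourierLegendre g (k + (d + 1))|
            * (Real.sqrt (2 / (2 * ((k + (d + 1) : ℕ) : ℝ) + 1))
              * Real.sqrt ((2 * ((k + (d + 1) : ℕ) : ℝ) + 1) / 2))
            / (((k + (d + 1) : ℕ) : ℝ) * (((k + (d + 1) : ℕ) : ℝ) + 1)) ^ 3 := by rw [hs, mul_one]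
      _ = _ := by ring
  rw [Finset.sum_congr rfl hfac]
  refine (Real.sum_mul_le_sqrt_mul_sqrt _ _ _).trans ?_
  have hB : ∑ k ∈ range n, (|fourierLegendre g (k + (d + 1))|
      * Real.sqrt (2 / (2 * ((k + (d + 1) : ℕ) : ℝ) + 1))) ^ 2 ≤ ∫ x in (-1 : ℝ)..1, g x ^ 2 := by
    have e : ∀ k ∈ range n, (|fourierLegendre g (k + (d + 1))|
        * Real.sqrt (2 / (2 * ((k + (d + 1) : ℕ) : ℝ) + 1))) ^ 2
        = fourierLegendre g (k + (d + 1)) ^ 2 * (2 / (2 * ((k + (d + 1) : ℕ) : ℝ) + 1)) := by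
      intro k _
      rw [mul_pow, sq_abs, Real.sq_sqrt (by positivity)]
    rw [Finset.sum_congr rfl e]
    refine (sum_shift_le (F := fun j => fourierLegendre g j ^ 2 * (2 / (2 * (j : ℝ) + 1)))
      (fun j => by positivity) d n).trans ?_
    have := bessel hgc (n + d)
    rwa [show n + d + 1 = n + (d + 1) by ring] at this
  have hW := sum_weight_sq_le3 hd n
  have hBnn : 0 ≤ ∫ x in (-1 : ℝ)..1, g x ^ 2 := integral_nonneg (by norm_num) fun x _ => sq_nonneg _
  calc Real.sqrt (∑ k ∈ range n, (|fourierLegendre g (k + (d + 1))|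
          * Real.sqrt (2 / (2 * ((k + (d + 1) : ℕ) : ℝ) + 1))) ^ 2)
        * Real.sqrt (∑ k ∈ range n, (Real.sqrt ((2 * ((k + (d + 1) : ℕ) : ℝ) + 1) / 2)
          / (((k + (d + 1) : ℕ) : ℝ) * (((k + (d + 1) : ℕ) : ℝ) + 1)) ^ 3) ^ 2)
      ≤ Real.sqrt (∫ x in (-1 : ℝ)..1, g x ^ 2) * Real.sqrt (1 / (d : ℝ) ^ 10) := by gcongr
    _ = Real.sqrt (∫ x in (-1 : ℝ)..1, g x ^ 2) / (d : ℝ) ^ 5 := by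
        have : Real.sqrt (1 / (d : ℝ) ^ 10) = 1 / (d : ℝ) ^ 5 := by
          rw [show (1 : ℝ) / (d : ℝ) ^ 10 = (1 / (d : ℝ) ^ 5) ^ 2 by ring]
          exact Real.sqrt_sq (by positivity)
        rw [this]
        ring

/-- **THE RATE `O(d⁻⁵)` FOR `C⁶` FUNCTIONS**: `|f(x) − S_d f(x)| ≤ √(∫_{−1}^{1} (L³f)²) / d⁵` on `[−1, 1]`, `d ≥ 1`. -/
theorem abs_sub_partialSum_le_div_pow_five {d : ℕ} (hd : 1 ≤ d) {x : ℝ} (hx : x ∈ Icc (-1 : ℝ) 1) :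
    |f x - partialSum f d x| ≤ Real.sqrt (∫ x in (-1 : ℝ)..1, sturm3 f₁ f₂ f₃ f₄ f₅ f₆ x ^ 2) / (d : ℝ) ^ 5 := by
  have c₂ : ContinuousOn f₂ (Icc (-1 : ℝ) 1) := fun x hx => (h₃ x hx).continuousAt.continuousWithinAt
  refine (abs_sub_partialSum_le h₁ h₂ c₂ d hx).trans ?_
  exact Real.tsum_le_of_sum_range_le (fun k => abs_nonneg _)
    fun n => sum_abs_fourierLegendre_shift_le3 h₁ h₂ h₃ h₄ h₅ h₆ h₆c hd n

end C6

/-! ### Every `C⁶` function on `ℝ` -/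

/-- The derivative data of an `f ∈ C⁶(ℝ)`: the iterated derivatives `deriv^[j] f`, `j ≤ 6`. -/
theorem hasDerivAt_of_contDiff6 {f : ℝ → ℝ} (hf : ContDiff ℝ 6 f) :
    (∀ x ∈ Icc (-1 : ℝ) 1, HasDerivAt f (deriv f x) x) ∧
      (∀ x ∈ Icc (-1 : ℝ) 1, HasDerivAt (deriv f) (deriv^[2] f x) x) ∧
        (∀ x ∈ Icc (-1 : ℝ) 1, HasDerivAt (deriv^[2] f) (deriv^[3] f x) x) ∧
          (∀ x ∈ Icc (-1 : ℝ) 1, HasDerivAt (deriv^[3] f) (deriv^[4] f x) x) ∧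
            (∀ x ∈ Icc (-1 : ℝ) 1, HasDerivAt (deriv^[4] f) (deriv^[5] f x) x) ∧
              (∀ x ∈ Icc (-1 : ℝ) 1, HasDerivAt (deriv^[5] f) (deriv^[6] f x) x) ∧
                ContinuousOn (deriv^[6] f) (Icc (-1 : ℝ) 1) := by
  have h1 : ContDiff ℝ 5 (deriv f) := by simpa using hf.iterate_deriv' 5 1
  have h2 : ContDiff ℝ 4 (deriv^[2] f) := by simpa using hf.iterate_deriv' 4 2
  have h3 : ContDiff ℝ 3 (deriv^[3] f) := by simpa using hf.iterate_deriv' 3 3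
  have h4 : ContDiff ℝ 2 (deriv^[4] f) := by simpa using hf.iterate_deriv' 2 4
  have h5 : ContDiff ℝ 1 (deriv^[5] f) := by simpa using hf.iterate_deriv' 1 5
  have h6 : Continuous (deriv^[6] f) := by simpa using (hf.iterate_deriv' 0 6).continuous
  have e : ∀ j x, deriv (deriv^[j] f) x = deriv^[j + 1] f x := fun j x =>
    (congrFun (Function.iterate_succ_apply' deriv j f) x).symm
  refine ⟨fun x _ => (hf.differentiable (by norm_num) x).hasDerivAt,
    fun x _ => (h1.differentiable (by norm_num) x).hasDerivAt, fun x _ => ?_, fun x _ => ?_, fun x _ => ?_,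
    fun x _ => ?_, h6.continuousOn⟩
  · have := (h2.differentiable (by norm_num) x).hasDerivAt
    rwa [e 2 x] at this
  · have := (h3.differentiable (by norm_num) x).hasDerivAt
    rwa [e 3 x] at this
  · have := (h4.differentiable (by norm_num) x).hasDerivAt
    rwa [e 4 x] at this
  · have := (h5.differentiable one_ne_zero x).hasDerivAt
    rwa [e 5 x] at this

/-- **The rate `O(d⁻⁵)` for every `f ∈ C⁶(ℝ)`.** -/
theorem abs_sub_partialSum_le_div_pow_five_of_contDiff {f : ℝ → ℝ} (hf : ContDiff ℝ 6 f) {d : ℕ} (hd : 1 ≤ d)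
    {x : ℝ} (hx : x ∈ Icc (-1 : ℝ) 1) :
    |f x - partialSum f d x|
      ≤ Real.sqrt (∫ x in (-1 : ℝ)..1,
          sturm3 (deriv f) (deriv^[2] f) (deriv^[3] f) (deriv^[4] f) (deriv^[5] f) (deriv^[6] f) x ^ 2)
        / (d : ℝ) ^ 5 :=
  let ⟨h₁, h₂, h₃, h₄, h₅, h₆, h₆c⟩ := hasDerivAt_of_contDiff6 hf
  abs_sub_partialSum_le_div_pow_five h₁ h₂ h₃ h₄ h₅ h₆ h₆c hd hx

end Summit.Ventures.HodgeRepro2.T5SU11LegendreSeriesRateC6
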